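import Summits.ValiantsHypothesis.ValiantsHypothesis.Theorems.LacunarySymmetroidMatrixDescartesCensusDoorA34ReducibleCone

/-!
# `MatrixDescartes` census — DOOR A at `(3,4)`: TWO COMMON ISOTROPIC VECTORS ⇒ `Z₊ ≤ 12`, ALL supports

HONEST FRAMING.  Object-search cell `pub-symmetroid`, door-A seat `val-sym-door-p3` (g23); a PARTIAL-RANGE row `--supports` the route
item `Theses.LacunarySymmetroid.DoorA34` (stmt-ValiantsHypothesis-19980, `DoorA34 = PosRootLawAt 3 4 18`), OPEN and asserted nowhere here.
The four-letter ISOTROPIC sector (one common isotropic vector, `…CensusDoorA34Isotropic*`) is a `10`-dimensional linear family of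
`20`-nomials with Descartes ceiling `19` and no proved ceiling below it.  One common isotropic vector further, the family collapses:

* `gramMatrix_eq`, `det_gram_two_isotropic` — in a basis `(c₁, c₂, c₃)` with `c₁ᵀMc₁ = c₂ᵀMc₂ = 0` the Gram matrix `(cᵢᵀMcⱼ)` of a
  symmetric `M` is `[[0,m,a],[m,0,b],[a,b,e]]`, whose determinant is `m·(2ab − m e)`, and `det(R M Rᵀ) = det(R)²·det M`;
* `bilin_pencil_eval` — `uᵀ(∑ t^{d_l}S_l)v = ∑ (uᵀS_lv)·t^{d_l}`;
* **`card_posRoots_le_twelve_of_two_isotropic`** — if the real symmetric letters `S_l` (`3 × 3`, four of them, any support `d`) have TWO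
  linearly independent common isotropic vectors `c₁, c₂` (`cᵢᵀS_lcᵢ = 0` for all `l`), the pencil has at most `3 + 9 = 12` distinct positive
  det-roots: `det(∑ t^{d_l}S_l)·det(R)² = m(t)·(2a(t)b(t) − m(t)e(t))` with the `4`-nomial `m = c₁ᵀM(·)c₂` (`≤ 3` roots,
  `Census.card_posRoots_borderNomial_le`) and a pair-nomial (`≤ 9`, `Census.ReducibleCone.card_posRoots_pairNomial_le`);
  `doorA34_ineq_on_two_isotropic` — hence `≤ 18` there.

READING (report `DOOR-A34-P3G23-REPORT` §3): at the `19` roots of a hypothetical all-middle nineteen every Rayleigh `4`-nomial `uᵀM(x)u`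
has `≤ 3` sign changes along the roots; the only exact way to meet this for ALL `u` with kernel lines in general position is Steiner's
generation — boundary planes of the `19` crosses through two FIXED directions `c₁, c₂`, which are then common isotropic vectors — and this
file shows that configuration carries at most `12` roots.  Nothing here bounds `ζ_sym(3,4)` beyond this sector; `DoorA34` and `MatrixDescartes`
(stmt-ValiantsHypothesis-18050) stay OPEN; nothing bears on `VP ≠ VNP`.  [folklore] Elementary.
-/

-- `Summit.ValiantsHypothesis.ValiantsHypothesis.…` repeats a component by the D-0017 layout
-- (single-conjunct summit), which the `dupNamespace` linter flags; the name is mandated.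
set_option linter.dupNamespace false

namespace Summit.ValiantsHypothesis.ValiantsHypothesis.Theorems.LacunarySymmetroidMatrixDescartes.Census

open Polynomial Finset Matrix
open scoped BigOperators Polynomial Matrix
open Summit.ValiantsHypothesis.ValiantsHypothesis.Theorems.MatrixDescartes.Negative (PosRootLawAt)
open Summit.ValiantsHypothesis.ValiantsHypothesis.Theorems.SymmetroidDescartes (eval_det_pencil)

namespace TwoIsotropic

/-- The Gram matrix of `M` in the rows `c₀, c₁, c₂` of `R`: `(R M Rᵀ)ᵢⱼ = cᵢᵀ M cⱼ`. [folklore] -/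
theorem gramMatrix_eq (c : Fin 3 → Fin 3 → ℝ) (M : Matrix (Fin 3) (Fin 3) ℝ) :
    Matrix.of c * M * (Matrix.of c)ᵀ = Matrix.of fun i j => c i ⬝ᵥ (M *ᵥ c j) := by
  ext i j
  simp only [Matrix.mul_apply, Matrix.transpose_apply, Matrix.of_apply, dotProduct, Matrix.mulVec, Finset.sum_mul,
    Finset.mul_sum]
  rw [Finset.sum_comm]
  exact Finset.sum_congr rfl fun a _ => Finset.sum_congr rfl fun b _ => by ring

/-- `det [[0,m,a],[m,0,b],[a,b,e]] = m·(2ab − m e)` — the determinant of a symmetric `3 × 3` matrix with two zero diagonal entries.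
[folklore] -/
theorem det_hollow_two (m a b e : ℝ) : (!![0, m, a; m, 0, b; a, b, e] : Matrix (Fin 3) (Fin 3) ℝ).det = m * (2 * a * b - m * e) := by
  simp [Matrix.det_fin_three]
  ring

/-- With two isotropic rows `c₀, c₁` (`cᵢᵀMcᵢ = 0`) and `M` symmetric: `det(R)²·det M = m·(2ab − m e)` with `m = c₀ᵀMc₁`, `a = c₀ᵀMc₂`,
`b = c₁ᵀMc₂`, `e = c₂ᵀMc₂`. [folklore] -/
theorem det_gram_two_isotropic (c : Fin 3 → Fin 3 → ℝ) (M : Matrix (Fin 3) (Fin 3) ℝ) (hM : M.IsSymm)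
    (h0 : c 0 ⬝ᵥ (M *ᵥ c 0) = 0) (h1 : c 1 ⬝ᵥ (M *ᵥ c 1) = 0) :
    (Matrix.of c).det ^ 2 * M.det
      = (c 0 ⬝ᵥ (M *ᵥ c 1)) * (2 * (c 0 ⬝ᵥ (M *ᵥ c 2)) * (c 1 ⬝ᵥ (M *ᵥ c 2)) - (c 0 ⬝ᵥ (M *ᵥ c 1)) * (c 2 ⬝ᵥ (M *ᵥ c 2))) := by
  have hsy : ∀ u v : Fin 3 → ℝ, u ⬝ᵥ (M *ᵥ v) = v ⬝ᵥ (M *ᵥ u) := fun u v => by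
    rw [Matrix.dotProduct_mulVec, ← Matrix.mulVec_transpose, hM.eq, dotProduct_comm]
  have hdet : (Matrix.of c * M * (Matrix.of c)ᵀ).det = (Matrix.of c).det ^ 2 * M.det := by
    rw [Matrix.det_mul, Matrix.det_mul, Matrix.det_transpose]; ring
  rw [← hdet, gramMatrix_eq]
  have hG : (Matrix.of fun i j => c i ⬝ᵥ (M *ᵥ c j))
      = !![0, c 0 ⬝ᵥ (M *ᵥ c 1), c 0 ⬝ᵥ (M *ᵥ c 2); c 0 ⬝ᵥ (M *ᵥ c 1), 0, c 1 ⬝ᵥ (M *ᵥ c 2);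
          c 0 ⬝ᵥ (M *ᵥ c 2), c 1 ⬝ᵥ (M *ᵥ c 2), c 2 ⬝ᵥ (M *ᵥ c 2)] := by
    ext i j
    fin_cases i <;> fin_cases j <;> simp [h0, h1, hsy (c 1) (c 0), hsy (c 2) (c 0), hsy (c 2) (c 1)]
  rw [hG, det_hollow_two]

/-- Bilinear evaluation of a pencil: `uᵀ(∑ t^{d_l} S_l)v = ∑ (uᵀS_lv)·t^{d_l}`. [folklore] -/
theorem bilin_pencil_eval {K : ℕ} (d : Fin K → ℕ) (S : Fin K → Matrix (Fin 3) (Fin 3) ℝ) (u v : Fin 3 → ℝ) (t : ℝ) :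
    u ⬝ᵥ ((∑ l, t ^ d l • S l) *ᵥ v) = ∑ l, (u ⬝ᵥ (S l *ᵥ v)) * t ^ d l := by
  rw [Matrix.sum_mulVec, dotProduct_sum]
  exact Finset.sum_congr rfl fun l _ => by rw [Matrix.smul_mulVec, dotProduct_smul, smul_eq_mul, mul_comm]

/-- **TWO COMMON ISOTROPIC VECTORS ⇒ AT MOST `12` POSITIVE DET-ROOTS (all supports).**  If the four real symmetric `3 × 3` letters
`S_l` admit linearly independent `c₁, c₂` with `c₁ᵀS_lc₁ = c₂ᵀS_lc₂ = 0` for every `l` (completed to a basis by `c₃`: `det[c₁,c₂,c₃] ≠ 0`),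
then `det(∑ X^{d_l}S_l)` has at most `12` distinct positive roots. [folklore] -/
theorem card_posRoots_le_twelve_of_two_isotropic (d : Fin 4 → ℕ) (S : Fin 4 → Matrix (Fin 3) (Fin 3) ℝ)
    (hS : ∀ l, (S l).IsSymm) (c : Fin 3 → Fin 3 → ℝ) (hc : (Matrix.of c).det ≠ 0)
    (h0 : ∀ l, c 0 ⬝ᵥ (S l *ᵥ c 0) = 0) (h1 : ∀ l, c 1 ⬝ᵥ (S l *ᵥ c 1) = 0) :
    (((∑ l, (X : ℝ[X]) ^ d l • (S l).map C).det).roots.toFinset.filter (fun t => 0 < t)).card ≤ 12 := by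
  classical
  set P : ℝ[X] := (∑ l, (X : ℝ[X]) ^ d l • (S l).map C).det with hPdef
  -- the scalar 4-nomials `m, a, b, e`
  set mP : ℝ[X] := ∑ l, C (c 0 ⬝ᵥ (S l *ᵥ c 1)) * (X : ℝ[X]) ^ d l with hmP
  set qP : ℝ[X] := ∑ p : Fin 4 × Fin 4,
      C (2 * (c 0 ⬝ᵥ (S p.1 *ᵥ c 2)) * (c 1 ⬝ᵥ (S p.2 *ᵥ c 2)) - (c 0 ⬝ᵥ (S p.1 *ᵥ c 1)) * (c 2 ⬝ᵥ (S p.2 *ᵥ c 2)))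
        * (X : ℝ[X]) ^ (d p.1 + d p.2) with hqP
  have hMsymm : ∀ t : ℝ, (∑ l, t ^ d l • S l).IsSymm := by
    intro t
    unfold Matrix.IsSymm
    rw [Matrix.transpose_sum]
    exact Finset.sum_congr rfl fun l _ => by rw [Matrix.transpose_smul, (hS l).eq]
  have hiso0 : ∀ t : ℝ, c 0 ⬝ᵥ ((∑ l, t ^ d l • S l) *ᵥ c 0) = 0 := fun t => by
    rw [bilin_pencil_eval]; exact Finset.sum_eq_zero fun l _ => by rw [h0 l, zero_mul]
  have hiso1 : ∀ t : ℝ, c 1 ⬝ᵥ ((∑ l, t ^ d l • S l) *ᵥ c 1) = 0 := fun t => by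
    rw [bilin_pencil_eval]; exact Finset.sum_eq_zero fun l _ => by rw [h1 l, zero_mul]
  have hmeval : ∀ t : ℝ, mP.eval t = c 0 ⬝ᵥ ((∑ l, t ^ d l • S l) *ᵥ c 1) := fun t => by
    rw [hmP, eval_nodePoly, bilin_pencil_eval]
  have hqeval : ∀ t : ℝ, qP.eval t
      = 2 * (c 0 ⬝ᵥ ((∑ l, t ^ d l • S l) *ᵥ c 2)) * (c 1 ⬝ᵥ ((∑ l, t ^ d l • S l) *ᵥ c 2))
        - (c 0 ⬝ᵥ ((∑ l, t ^ d l • S l) *ᵥ c 1)) * (c 2 ⬝ᵥ ((∑ l, t ^ d l • S l) *ᵥ c 2)) := fun t => by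
    rw [hqP, eval_finsetSum, bilin_pencil_eval, bilin_pencil_eval, bilin_pencil_eval, bilin_pencil_eval]
    simp only [eval_mul, eval_C, eval_pow, eval_X, Fintype.sum_prod_type, Fin.sum_univ_four, pow_add]
    ring
  -- the factorisation of `det(R)² · P(t)`
  have hevalP : ∀ t : ℝ, (Matrix.of c).det ^ 2 * P.eval t = mP.eval t * qP.eval t := fun t => by
    rw [hPdef, eval_det_pencil, det_gram_two_isotropic c _ (hMsymm t) (hiso0 t) (hiso1 t), hmeval, hqeval]
  by_cases hP : P = 0
  · rw [hP, Polynomial.roots_zero, Multiset.toFinset_zero, Finset.filter_empty, Finset.card_empty]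
    exact Nat.zero_le _
  have hc2 : (Matrix.of c).det ^ 2 ≠ 0 := pow_ne_zero 2 hc
  have hm0 : mP ≠ 0 := by
    intro h; apply hP; apply RankTwoNet.eq_zero_of_forall_pos_isRoot; intro t _
    have := hevalP t
    rw [h, eval_zero, zero_mul] at this
    exact (mul_eq_zero.mp this).resolve_left hc2
  have hq0 : qP ≠ 0 := by
    intro h; apply hP; apply RankTwoNet.eq_zero_of_forall_pos_isRoot; intro t _
    have := hevalP t
    rw [h, eval_zero, mul_zero] at this
    exact (mul_eq_zero.mp this).resolve_left hc2
  have hcover : (P.roots.toFinset.filter (fun t => 0 < t))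
      ⊆ (mP.roots.toFinset.filter (fun t => 0 < t)) ∪ (qP.roots.toFinset.filter (fun t => 0 < t)) := by
    intro t ht
    rw [Finset.mem_filter, Multiset.mem_toFinset, Polynomial.mem_roots hP, Polynomial.IsRoot.def] at ht
    rw [Finset.mem_union, Finset.mem_filter, Finset.mem_filter, Multiset.mem_toFinset, Multiset.mem_toFinset,
      Polynomial.mem_roots hm0, Polynomial.mem_roots hq0, Polynomial.IsRoot.def, Polynomial.IsRoot.def]
    have h := hevalP t
    rw [ht.1, mul_zero] at h
    rcases mul_eq_zero.mp h.symm with h' | h'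
    · exact Or.inl ⟨h', ht.2⟩
    · exact Or.inr ⟨h', ht.2⟩
  have hmcard : (mP.roots.toFinset.filter (fun t => 0 < t)).card ≤ 3 :=
    card_posRoots_borderNomial_le d (fun l => c 0 ⬝ᵥ (S l *ᵥ c 1)) hm0
  have hqcard : (qP.roots.toFinset.filter (fun t => 0 < t)).card ≤ 9 := ReducibleCone.card_posRoots_pairNomial_le d _ hq0
  calc (P.roots.toFinset.filter (fun t => 0 < t)).card
      ≤ ((mP.roots.toFinset.filter (fun t => 0 < t)) ∪ (qP.roots.toFinset.filter (fun t => 0 < t))).card :=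
        Finset.card_le_card hcover
    _ ≤ (mP.roots.toFinset.filter (fun t => 0 < t)).card + (qP.roots.toFinset.filter (fun t => 0 < t)).card :=
        Finset.card_union_le _ _
    _ ≤ 12 := by omega

/-- Hence the door's `≤ 18` on pencils with two common isotropic vectors, for every support `d`. [folklore] -/
theorem doorA34_ineq_on_two_isotropic (d : Fin 4 → ℕ) (S : Fin 4 → Matrix (Fin 3) (Fin 3) ℝ)
    (hS : ∀ l, (S l).IsSymm) (c : Fin 3 → Fin 3 → ℝ) (hc : (Matrix.of c).det ≠ 0)
    (h0 : ∀ l, c 0 ⬝ᵥ (S l *ᵥ c 0) = 0) (h1 : ∀ l, c 1 ⬝ᵥ (S l *ᵥ c 1) = 0) :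
    (((∑ l, (X : ℝ[X]) ^ d l • (S l).map C).det).roots.toFinset.filter (fun t => 0 < t)).card ≤ 18 :=
  (card_posRoots_le_twelve_of_two_isotropic d S hS c hc h0 h1).trans (by norm_num)

end TwoIsotropic

end Summit.ValiantsHypothesis.ValiantsHypothesis.Theorems.LacunarySymmetroidMatrixDescartes.Census
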